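import Summits.QuantumFields.QCD.Theses.NestedDissectionSea
import Summits.QuantumFields.QCD.Theorems.CoerciveSea.Negative.SeilerBothSides
import Summits.QuantumFields.QCD.Theorems.CoerciveSea.Negative.CellDeterminants

/-!
# Crux `CoerciveSea` (stmt-QuantumFields-13901), negative side, 4/4 — the pin is the whole content

Support file of the standing disprover (cdisprove seat) of the hinge crux `CoerciveSea` of route
`NestedDissectionSea`.  No refutation (the crux survives cycle 1); load-bearing analysis, sorry-free:

* `PinClause` / `CoerciveSeaAt` / `CoerciveSeaWithoutPinAt` / `CoerciveSeaWithoutPin`: VERBATIM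
  abbreviations of clause (iii), of the crux body at a given regularisation, and of the crux with
  (iii) deleted (`coerciveSea_iff : CoerciveSea ↔ ∀ Nf ∈ {2,3}, ∃ reg, CoerciveSeaAt Nf reg` is
  `Iff.rfl`).  These are statement abbreviations for the analysis, not facts.
* `PinClause.mass_mem_Ioo`, `coerciveSea_pin_mass_mem_Ioo`: for ANY witness of the crux and every
  `M > M₀`, eventually `mcrit k − a_k M / Z_m k ∈ (−8, 0)` (off that interval the pin event is empty
  by `SeilerBothSides`); `not_coerciveSeaAt_of_frequently_le_neg_eight`,
  `not_coerciveSeaAt_of_frequently_ge` (`N_f ≤ 16`, via `tendsto_a_div_Zm` from `HasMassScaling`),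
  `not_coerciveSeaAt_heavyJunkReg`: the deep and the heavy junk regularisations are not witnesses.
* `coerciveSeaWithoutPin_holds`: the crux with the pin deleted holds OUTRIGHT by the heavy junk
  regularisation `heavyJunkReg` (`canonicalAF` with `mcrit ≡ 1`): clauses (i),(ii) are vacuous there
  (`CellCoercivity`, `CellDeterminants`); `heavyJunk_dichotomy` pairs this with Part A.
  Moral for provers: all non-trivial content of the hinge enters through the pin — through locating
  `mcrit` on the physical branch — and (i),(ii) must be proved THERE. [folklore]
-/

noncomputable section

open scoped BigOperators ComplexConjugate Classical
open MeasureTheory Filter Matrix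
open Literature.MathematicalPhysics.QuantumLattice Literature.MathematicalPhysics.QuantumFieldTheory
  Literature.Probability.LatticeModels

namespace Summit.QuantumFields.QCD.Theorems.CoerciveSeaNegative

/-! ## Part A.2 — the pin clause forces the pin masses into the OPEN interval `(-8, 0)` -/

section Closure

variable {L N : ℕ} [NeZero L] {G : Type*} [Group G] (ρ : G →* Matrix (Fin N) (Fin N) ℂ)

/-- The Wilson determinant is continuous in the bare mass (a polynomial). [folklore] -/
theorem continuous_fermionDet_wilsonDirac_mass (hρ : ∀ g, ρ g ∈ Matrix.unitaryGroup (Fin N) ℂ)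
    (U : GaugeConfig 4 L G) : Continuous fun m : ℝ => fermionDet (wilsonDirac ρ U m 1) := by
  have h : Continuous fun m : ℝ =>
      ((m + 4 : ℝ) : ℂ) • (1 : Matrix (TorusSite 4 L × Fin N × Fin 4) _ ℂ) - ∑ μ, wilsonHop ρ U μ :=
    ((Complex.continuous_ofReal.comp (continuous_id.add continuous_const)).smul
      continuous_const).sub continuous_const
  simp_rw [fermionDet, wilsonDirac_eq_sub_sum_wilsonHop ρ hρ]
  exact h.matrix_det

/-- **Closure of Seiler positivity**: `Re det D_W(U, m, 1) ≥ 0` for `m ≥ 0` and for `m ≤ −8`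
(limits of the open positivity ranges `m > 0`, `m < −8`). So the pin event `Re det < 0` is EMPTY
at every bare mass outside the open interval `(−8, 0)`. [folklore] -/
theorem fermionDet_wilsonDirac_re_nonneg (hρ : ∀ g, ρ g ∈ Matrix.unitaryGroup (Fin N) ℂ)
    (U : GaugeConfig 4 L G) {m : ℝ} (hm : 0 ≤ m ∨ m ≤ -8) :
    0 ≤ (fermionDet (wilsonDirac ρ U m 1)).re := by
  set f : ℝ → ℝ := fun x => (fermionDet (wilsonDirac ρ U x 1)).re with hf
  have hcont : Continuous f :=
    Complex.continuous_re.comp (continuous_fermionDet_wilsonDirac_mass ρ hρ U)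
  rcases hm with hm | hm
  · rcases hm.lt_or_eq with hlt | heq
    · exact (fermionDet_wilsonDirac_re_pos_of_pos_or_lt ρ hρ U (Or.inl hlt)).le
    · subst heq
      have ht : Filter.Tendsto f (nhdsWithin 0 (Set.Ioi 0)) (nhds (f 0)) :=
        (hcont.tendsto 0).mono_left nhdsWithin_le_nhds
      have hev : ∀ᶠ x in nhdsWithin (0 : ℝ) (Set.Ioi 0), (0 : ℝ) ≤ f x :=
        eventually_nhdsWithin_of_forall fun x hx =>
          (fermionDet_wilsonDirac_re_pos_of_pos_or_lt ρ hρ U (Or.inl hx)).le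
      exact ge_of_tendsto ht hev
  · rcases hm.lt_or_eq with hlt | heq
    · exact (fermionDet_wilsonDirac_re_pos_of_pos_or_lt ρ hρ U (Or.inr hlt)).le
    · subst heq
      have ht : Filter.Tendsto f (nhdsWithin (-8) (Set.Iio (-8))) (nhds (f (-8))) :=
        (hcont.tendsto (-8)).mono_left nhdsWithin_le_nhds
      have hev : ∀ᶠ x in nhdsWithin (-8 : ℝ) (Set.Iio (-8)), (0 : ℝ) ≤ f x :=
        eventually_nhdsWithin_of_forall fun x hx =>
          (fermionDet_wilsonDirac_re_pos_of_pos_or_lt ρ hρ U (Or.inr hx)).le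
      exact ge_of_tendsto ht hev

end Closure


/-- **The pin clause (iii) of `CoerciveSea`, VERBATIM** (for `Nf`, a regularisation `reg`, the
threshold `M₀`, the mass tuple `m` entering the phase-quenched weight, and the physical size `R`):
for every `M > M₀`, eventually in `k`, on every odd torus of physical side `≥ R`, the phase-quenched
probability that `Re det D_W(U, mcrit k − a_k M / Z_m k, 1) < 0` is at least `1/4`. -/
def PinClause (Nf : ℕ) (reg : QCDRegularisation Nf) (M₀ : ℝ) (m : Fin Nf → ℝ) (R : ℝ) : Prop :=
  ∀ M : ℝ, M₀ < M → ∀ᶠ k : ℕ in Filter.atTop, ∀ S : ℕ, R ≤ reg.a k * (2 * S + 1) →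
    let N : ℕ := 2 * S + 1
    let mq : Fin Nf → ℝ := fun f => reg.mcrit k + reg.a k * m f / reg.Zm k
    let wt : GaugeConfig 4 N (Matrix.specialUnitaryGroup (Fin 3) ℂ) → ℝ := fun U =>
      ∏ f, ‖fermionDet (wilsonDirac (fundamentalRep (Fin 3)) U (mq f) 1)‖
    (1 / 4 : ℝ) ≤
      (∫ U, (if (fermionDet (wilsonDirac (fundamentalRep (Fin 3)) U
              (reg.mcrit k - reg.a k * M / reg.Zm k) 1)).re < 0 then (1 : ℝ) else 0) * wt U
          ∂(wilsonMeasure (d := 4) (L := N) (fundamentalRep (Fin 3)) (reg.β k))) /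
        (∫ U, wt U ∂(wilsonMeasure (d := 4) (L := N) (fundamentalRep (Fin 3)) (reg.β k)))

/-- **`CoerciveSea` at a given regularisation**: the body of the crux after `∃ reg`, VERBATIM. -/
def CoerciveSeaAt (Nf : ℕ) (reg : QCDRegularisation Nf) : Prop :=
  reg.HasMassScaling ∧ (reg.scheme 0 0 0).HasAsymptoticScaling ∧ ∃ M₀ : ℝ, 0 ≤ M₀ ∧ ∃ b₀ : ℕ, 2 ≤ b₀ ∧ ∃ ℓ : ℝ, 0 < ℓ ∧ ∀ m : Fin Nf → ℝ, (∀ f, M₀ < m f) → ∃ R : ℝ, 0 < R ∧ (∃ C : ℝ, 0 < C ∧ ∃ α : ℝ, 0 < α ∧ ∀ᶠ k : ℕ in Filter.atTop, ∀ S : ℕ, R ≤ reg.a k * (2 * S + 1) → let N : ℕ := 2 * S + 1; let mq : Fin Nf → ℝ := fun f => reg.mcrit k + reg.a k * m f / reg.Zm k; let wt : GaugeConfig 4 N (Matrix.specialUnitaryGroup (Fin 3) ℂ) → ℝ := fun U => ∏ f, ‖fermionDet (wilsonDirac (fundamentalRep (Fin 3)) U (mq f) 1)‖; let P : (GaugeConfig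 4 N (Matrix.specialUnitaryGroup (Fin 3) ℂ) → Prop) → ℝ := fun E => (∫ U, (if E U then (1 : ℝ) else 0) * wt U ∂(wilsonMeasure (d := 4) (L := N) (fundamentalRep (Fin 3)) (reg.β k))) / (∫ U, wt U ∂(wilsonMeasure (d := 4) (L := N) (fundamentalRep (Fin 3)) (reg.β k))); ∀ s : Fin 4 → ℕ, (∀ i, b₀ ≤ s i ∧ s i ≤ N ∧ (s i : ℝ) * reg.a k ≤ ℓ) → (∀ i j, s i ≤ 2 * s j) → ∀ f : Fin Nf, ∀ t : ℝ, 0 < t → t ≤ 1 → P (fun U => HasSingularSeparator U (mq f) s (t / s 0)) ≤ C * t ^ α) ∧ (∀ ε : ℝ, 0 < ε → ∀ᶠ k : ℕ in Filter.atTop, ∀ S : ℕ, R ≤ reg.a k * (2 * S + 1) → let N : ℕ := 2 * S + 1; let mq : Fin Nf → ℝ := fun f => reg.mcrit k + reg.a k * m f / reg.Zm k; let wt : GaugeConfig 4 N (Matrix.specialUnitaryGroup (Fin 3) ℂ) → ℝ := fun U => ∏ f, ‖fermionDet (wilsonDirac (fundamentalRep (Fin 3)) U (mq f) 1)‖; let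 P : (GaugeConfig 4 N (Matrix.specialUnitaryGroup (Fin 3) ℂ) → Prop) → ℝ := fun E => (∫ U, (if E U then (1 : ℝ) else 0) * wt U ∂(wilsonMeasure (d := 4) (L := N) (fundamentalRep (Fin 3)) (reg.β k))) / (∫ U, wt U ∂(wilsonMeasure (d := 4) (L := N) (fundamentalRep (Fin 3)) (reg.β k))); let J : ℕ := Nat.log 2 (⌊ℓ / reg.a k⌋₊ / b₀) + 1; ∃ δ : ℕ → ℝ, ∑ j ∈ Finset.range J, δ j ≤ ε ∧ ∀ j < J, ∀ s : Fin 4 → ℕ, (∀ i, b₀ * 2 ^ j ≤ s i ∧ s i < b₀ * 2 ^ (j + 2) ∧ s i ≤ N ∧ (s i : ℝ) * reg.a k ≤ ℓ) → P (fun U => ∃ f, IsSignDefect U (mq f) j s) ≤ δ j) ∧ PinClause Nf reg M₀ m R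

/-- The crux is `∀ Nf ∈ {2,3}, ∃ reg, CoerciveSeaAt Nf reg` (definitional unfolding). -/
theorem coerciveSea_iff :
    Summit.QuantumFields.QCD.Theses.NestedDissectionSea.CoerciveSea ↔
      ∀ Nf : ℕ, (Nf = 2 ∨ Nf = 3) → ∃ reg : QCDRegularisation Nf, CoerciveSeaAt Nf reg :=
  Iff.rfl

/-- Every positive real is below `a_k (2S+1)` for some `S` (the torus sizes are unbounded).
[folklore] -/
theorem exists_torus_ge {Nf : ℕ} (reg : QCDRegularisation Nf) (k : ℕ) (R : ℝ) :
    ∃ S : ℕ, R ≤ reg.a k * (2 * S + 1) := by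
  obtain ⟨n, hn⟩ := exists_nat_ge (R / reg.a k)
  have ha := reg.a_pos k
  have hn' : R ≤ (n : ℝ) * reg.a k := by rwa [div_le_iff₀ ha] at hn
  have hn0 : (0 : ℝ) ≤ (n : ℝ) * reg.a k := mul_nonneg (Nat.cast_nonneg n) ha.le
  exact ⟨n, by nlinarith⟩

/-- **The pin window.** If the pin clause holds for `(reg, M₀, m, R)` then for every `M > M₀`,
eventually in `k`, the pin mass `μ₀ = mcrit k − a_k M / Z_m k` lies in the OPEN interval `(−8, 0)`:
outside it `Re det D_W(U, μ₀, 1) ≥ 0` for EVERY gauge field (`fermionDet_wilsonDirac_re_nonneg`),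
the pin event is empty, the phase-quenched ratio is `0 < 1/4`. Any proof of the crux must
therefore place `mcrit` within `a_k M₀/Z_m k` of `(−8, 0]`; the junk corners `mcrit ≫ 0` (where
(i),(ii) are vacuous, Part C) and `mcrit ≤ −8` are dead. [folklore] -/
theorem PinClause.mass_mem_Ioo {Nf : ℕ} {reg : QCDRegularisation Nf} {M₀ : ℝ} {m : Fin Nf → ℝ}
    {R : ℝ} (h : PinClause Nf reg M₀ m R) {M : ℝ} (hM : M₀ < M) :
    ∀ᶠ k : ℕ in Filter.atTop, reg.mcrit k - reg.a k * M / reg.Zm k ∈ Set.Ioo (-8 : ℝ) 0 := by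
  filter_upwards [h M hM] with k hk
  obtain ⟨S, hS⟩ := exists_torus_ge reg k R
  have hkS := hk S hS
  by_contra hout
  have hμ : 0 ≤ reg.mcrit k - reg.a k * M / reg.Zm k ∨ reg.mcrit k - reg.a k * M / reg.Zm k ≤ -8 := by
    simp only [Set.mem_Ioo, not_and_or, not_lt] at hout
    rcases hout with h1 | h1
    · exact Or.inr h1
    · exact Or.inl h1
  have hzero : ∀ U : GaugeConfig 4 (2 * S + 1) (Matrix.specialUnitaryGroup (Fin 3) ℂ),
      ¬ (fermionDet (wilsonDirac (fundamentalRep (Fin 3)) U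
          (reg.mcrit k - reg.a k * M / reg.Zm k) 1)).re < 0 := fun U =>
    not_lt.mpr (fermionDet_wilsonDirac_re_nonneg _ (fundamentalRep_mem_unitaryGroup) U hμ)
  simp only [hzero, if_false, zero_mul, integral_zero, zero_div] at hkS
  norm_num at hkS

/-- Projection of the crux onto its pin clause (clauses (i),(ii) dropped). -/
theorem CoerciveSeaAt.pin {Nf : ℕ} {reg : QCDRegularisation Nf} (h : CoerciveSeaAt Nf reg) :
    ∃ M₀ : ℝ, 0 ≤ M₀ ∧ ∀ m : Fin Nf → ℝ, (∀ f, M₀ < m f) → ∃ R : ℝ, 0 < R ∧ PinClause Nf reg M₀ m R := by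
  obtain ⟨-, -, M₀, hM₀, b₀, -, ℓ, -, hm⟩ := h
  refine ⟨M₀, hM₀, fun m hmm => ?_⟩
  obtain ⟨R, hR, -, -, hpin⟩ := hm m hmm
  exact ⟨R, hR, hpin⟩

/-- **Necessary condition on any witness of the crux**: its pin masses sit in `(−8, 0)`
eventually, for every `M` above its threshold. -/
theorem CoerciveSeaAt.mass_mem_Ioo {Nf : ℕ} {reg : QCDRegularisation Nf} (h : CoerciveSeaAt Nf reg) :
    ∃ M₀ : ℝ, 0 ≤ M₀ ∧ ∀ M : ℝ, M₀ < M →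
      ∀ᶠ k : ℕ in Filter.atTop, reg.mcrit k - reg.a k * M / reg.Zm k ∈ Set.Ioo (-8 : ℝ) 0 := by
  obtain ⟨M₀, hM₀, hm⟩ := h.pin
  refine ⟨M₀, hM₀, fun M hM => ?_⟩
  haveI : Nonempty (Fin Nf → ℝ) := ⟨fun _ => M₀ + 1⟩
  obtain ⟨R, -, hpin⟩ := hm (fun _ => M₀ + 1) (fun _ => by linarith)
  exact hpin.mass_mem_Ioo hM

/-- The same read on the crux itself. -/
theorem coerciveSea_pin_mass_mem_Ioo
    (h : Summit.QuantumFields.QCD.Theses.NestedDissectionSea.CoerciveSea) (Nf : ℕ)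
    (hNf : Nf = 2 ∨ Nf = 3) :
    ∃ reg : QCDRegularisation Nf, reg.HasMassScaling ∧ ∃ M₀ : ℝ, 0 ≤ M₀ ∧ ∀ M : ℝ, M₀ < M →
      ∀ᶠ k : ℕ in Filter.atTop, reg.mcrit k - reg.a k * M / reg.Zm k ∈ Set.Ioo (-8 : ℝ) 0 := by
  obtain ⟨reg, hreg⟩ := coerciveSea_iff.mp h Nf hNf
  exact ⟨reg, hreg.1, hreg.mass_mem_Ioo⟩

/-! ## Part A.3 — junk regularisations excluded by the pin -/

/-- A regularisation whose critical mass dips to `−8` or below infinitely often is not a witness.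
[folklore] -/
theorem not_coerciveSeaAt_of_frequently_le_neg_eight {Nf : ℕ} {reg : QCDRegularisation Nf}
    (h8 : ∃ᶠ k : ℕ in Filter.atTop, reg.mcrit k ≤ -8) : ¬ CoerciveSeaAt Nf reg := by
  intro h
  obtain ⟨M₀, hM₀, hM⟩ := h.mass_mem_Ioo
  have hev := hM (M₀ + 1) (by linarith)
  refine (h8.and_eventually hev).exists.elim fun k hk => ?_
  obtain ⟨hlt, hmem⟩ := hk
  have hpos : 0 ≤ reg.a k * (M₀ + 1) / reg.Zm k :=
    div_nonneg (mul_nonneg (reg.a_pos k).le (by linarith)) (reg.Zm_pos k).le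
  have := hmem.1
  linarith

/-- `HasMassScaling` (with a positive leading-log exponent, i.e. `N_f ≤ 16`) and `a_k → 0` force
`a_k / Z_m k → 0`: `Z_m k ≥ (c/2)·(log a_k⁻²)^e ≥ c/2` eventually. [folklore] -/
theorem tendsto_a_div_Zm {Nf : ℕ} (reg : QCDRegularisation Nf) (hms : reg.HasMassScaling)
    (he : 0 < massExponent Nf) :
    Filter.Tendsto (fun k => reg.a k / reg.Zm k) Filter.atTop (nhds 0) := by
  obtain ⟨c, hc, hlim⟩ := hms
  -- eventually a_k < exp(-1/2), so log(1/a_k²) > 1 and its positive power exceeds 1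
  have ha0 := reg.tendsto_a
  have hsmall : ∀ᶠ k in Filter.atTop, reg.a k < Real.exp (-1) := by
    exact ha0.eventually (gt_mem_nhds (Real.exp_pos _))
  have hratio : ∀ᶠ k in Filter.atTop, c / 2 < reg.Zm k / Real.log (1 / reg.a k ^ 2) ^ massExponent Nf :=
    hlim.eventually (lt_mem_nhds (by linarith))
  have hZ : ∀ᶠ k in Filter.atTop, c / 2 ≤ reg.Zm k := by
    filter_upwards [hsmall, hratio] with k hk hr
    have ha := reg.a_pos k
    have hlog : 1 ≤ Real.log (1 / reg.a k ^ 2) := by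
      rw [Real.le_log_iff_exp_le (by positivity)]
      have h1 : reg.a k ^ 2 < Real.exp (-1) ^ 2 := by gcongr
      have h2 : Real.exp (-1) ^ 2 = (Real.exp 1)⁻¹ ^ 2 := by rw [Real.exp_neg]
      rw [one_div, le_inv_comm₀ (Real.exp_pos 1) (by positivity)]
      calc reg.a k ^ 2 ≤ Real.exp (-1) ^ 2 := h1.le
        _ = Real.exp (-2) := by rw [← Real.exp_nat_mul]; norm_num
        _ ≤ (Real.exp 1)⁻¹ := by
            rw [← Real.exp_neg]; exact Real.exp_le_exp.mpr (by norm_num)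
    have hpow : 1 ≤ Real.log (1 / reg.a k ^ 2) ^ massExponent Nf :=
      Real.one_le_rpow hlog he.le
    have hpos : 0 < Real.log (1 / reg.a k ^ 2) ^ massExponent Nf := by linarith
    rw [lt_div_iff₀ hpos] at hr
    nlinarith
  -- squeeze 0 ≤ a/Z ≤ (2/c) a → 0
  have hupper : Filter.Tendsto (fun k => 2 / c * reg.a k) Filter.atTop (nhds 0) := by
    simpa using ha0.const_mul (2 / c)
  refine tendsto_of_tendsto_of_tendsto_of_le_of_le' tendsto_const_nhds hupper ?_ ?_
  · filter_upwards with k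
    exact div_nonneg (reg.a_pos k).le (reg.Zm_pos k).le
  · filter_upwards [hZ] with k hk
    have ha := reg.a_pos k
    have hZp := reg.Zm_pos k
    rw [div_le_iff₀ hZp]
    calc reg.a k = 2 / c * reg.a k * (c / 2) := by field_simp
      _ ≤ 2 / c * reg.a k * reg.Zm k := by gcongr

/-- The leading-log exponent is positive for `N_f = 2, 3` (indeed for `N_f ≤ 16`). [folklore] -/
theorem massExponent_pos {Nf : ℕ} (hNf : Nf ≤ 16) : 0 < massExponent Nf := by
  have hπ : 0 < Real.pi ^ 2 := by positivity
  have hN : (Nf : ℝ) ≤ 16 := by exact_mod_cast hNf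
  unfold massExponent gammaCoeff₀ betaCoeff₀
  apply div_pos (by positivity)
  apply mul_pos two_pos
  apply div_pos _ (by positivity)
  linarith

/-- **The heavy junk corner is dead.** A regularisation whose critical mass stays above a
positive constant infinitely often — the regime where clauses (i) and (ii) hold VACUOUSLY
(Part C) — cannot witness the crux for `N_f ≤ 16`: `a_k M / Z_m k → 0` by `HasMassScaling`, so
the pin mass is eventually positive there, contradicting `PinClause.mass_mem_Ioo`. -/
theorem not_coerciveSeaAt_of_frequently_ge {Nf : ℕ} (hNf : Nf ≤ 16) {reg : QCDRegularisation Nf}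
    {c : ℝ} (hc : 0 < c) (hge : ∃ᶠ k : ℕ in Filter.atTop, c ≤ reg.mcrit k) :
    ¬ CoerciveSeaAt Nf reg := by
  intro h
  have hms : reg.HasMassScaling := h.1
  obtain ⟨M₀, hM₀, hM⟩ := h.mass_mem_Ioo
  have hev := hM (M₀ + 1) (by linarith)
  have haz := tendsto_a_div_Zm reg hms (massExponent_pos hNf)
  have hsmall : ∀ᶠ k in Filter.atTop, reg.a k / reg.Zm k < c / (M₀ + 1) :=
    haz.eventually (gt_mem_nhds (by positivity))
  refine (hge.and_eventually (hev.and hsmall)).exists.elim fun k hk => ?_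
  obtain ⟨hck, hmem, hs⟩ := hk
  have hM1 : (0 : ℝ) < M₀ + 1 := by linarith
  have h1 : reg.a k * (M₀ + 1) / reg.Zm k < c := by
    rw [mul_comm, mul_div_assoc]
    calc (M₀ + 1) * (reg.a k / reg.Zm k) < (M₀ + 1) * (c / (M₀ + 1)) := by gcongr
      _ = c := by field_simp
  have := hmem.2
  linarith

/-- The concrete heavy junk regularisation: `canonicalAF` (the tree's non-vacuity witness of both
scalings) with its critical mass parked at `+1`. Clauses (i),(ii) hold vacuously for it (Part C),
yet it is NOT a witness of `CoerciveSea` for `N_f ≤ 16`. -/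
def heavyJunkReg (Nf : ℕ) : QCDRegularisation Nf :=
  { QCDRegularisation.canonicalAF Nf with mcrit := fun _ => 1 }

/-- The heavy junk regularisation is not a witness of the crux (`N_f ≤ 16`). [folklore] -/
theorem not_coerciveSeaAt_heavyJunkReg {Nf : ℕ} (hNf : Nf ≤ 16) :
    ¬ CoerciveSeaAt Nf (heavyJunkReg Nf) :=
  not_coerciveSeaAt_of_frequently_ge hNf one_pos
    (Filter.Eventually.frequently (Filter.Eventually.of_forall fun _ => le_rfl))

/-! ## Part C — without the pin the crux is TRIVIAL (junk witness `mcrit ≡ 1`) -/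

/-- **`CoerciveSea` with the pin clause (iii) deleted**, at a given regularisation: clauses (i)
(separator Wegner law in the window) and (ii) (windowed local dilution) only, VERBATIM. -/
def CoerciveSeaWithoutPinAt (Nf : ℕ) (reg : QCDRegularisation Nf) : Prop :=
  reg.HasMassScaling ∧ (reg.scheme 0 0 0).HasAsymptoticScaling ∧ ∃ M₀ : ℝ, 0 ≤ M₀ ∧ ∃ b₀ : ℕ, 2 ≤ b₀ ∧ ∃ ℓ : ℝ, 0 < ℓ ∧ ∀ m : Fin Nf → ℝ, (∀ f, M₀ < m f) → ∃ R : ℝ, 0 < R ∧ (∃ C : ℝ, 0 < C ∧ ∃ α : ℝ, 0 < α ∧ ∀ᶠ k : ℕ in Filter.atTop, ∀ S : ℕ, R ≤ reg.a k * (2 * S + 1) → let N : ℕ := 2 * S + 1; let mq : Fin Nf → ℝ := fun f => reg.mcrit k + reg.a k * m f / reg.Zm k; let wt : GaugeConfig 4 N (Matrix.specialUnitaryGroup (Fin 3) ℂ) → ℝ := fun U => ∏ f, ‖fermionDet (wilsonDirac (fundamentalRep (Fin 3)) U (mq f) 1)‖; let P : (GaugeConfig 4 N (Matrix.specialUnitaryGroup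 (Fin 3) ℂ) → Prop) → ℝ := fun E => (∫ U, (if E U then (1 : ℝ) else 0) * wt U ∂(wilsonMeasure (d := 4) (L := N) (fundamentalRep (Fin 3)) (reg.β k))) / (∫ U, wt U ∂(wilsonMeasure (d := 4) (L := N) (fundamentalRep (Fin 3)) (reg.β k))); ∀ s : Fin 4 → ℕ, (∀ i, b₀ ≤ s i ∧ s i ≤ N ∧ (s i : ℝ) * reg.a k ≤ ℓ) → (∀ i j, s i ≤ 2 * s j) → ∀ f : Fin Nf, ∀ t : ℝ, 0 < t → t ≤ 1 → P (fun U => HasSingularSeparator U (mq f) s (t / s 0)) ≤ C * t ^ α) ∧ (∀ ε : ℝ, 0 < ε → ∀ᶠ k : ℕ in Filter.atTop, ∀ S : ℕ, R ≤ reg.a k * (2 * S + 1) → let N : ℕ := 2 * S + 1; let mq : Fin Nf → ℝ := fun f => reg.mcrit k + reg.a k * m f / reg.Zm k; let wt : GaugeConfig 4 N (Matrix.specialUnitaryGroup (Fin 3) ℂ) → ℝ := fun U => ∏ f, ‖fermionDet (wilsonDirac (fundamentalRep (Fin 3)) U (mq f) 1)‖; let P : (GaugeConfig 4 N (Matrix.specialUnitaryGroup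 (Fin 3) ℂ) → Prop) → ℝ := fun E => (∫ U, (if E U then (1 : ℝ) else 0) * wt U ∂(wilsonMeasure (d := 4) (L := N) (fundamentalRep (Fin 3)) (reg.β k))) / (∫ U, wt U ∂(wilsonMeasure (d := 4) (L := N) (fundamentalRep (Fin 3)) (reg.β k))); let J : ℕ := Nat.log 2 (⌊ℓ / reg.a k⌋₊ / b₀) + 1; ∃ δ : ℕ → ℝ, ∑ j ∈ Finset.range J, δ j ≤ ε ∧ ∀ j < J, ∀ s : Fin 4 → ℕ, (∀ i, b₀ * 2 ^ j ≤ s i ∧ s i < b₀ * 2 ^ (j + 2) ∧ s i ≤ N ∧ (s i : ℝ) * reg.a k ≤ ℓ) → P (fun U => ∃ f, IsSignDefect U (mq f) j s) ≤ δ j)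

/-- `CoerciveSea` with the pin deleted (same `∀ Nf ∈ {2,3} ∃ reg` prefix). -/
def CoerciveSeaWithoutPin : Prop :=
  ∀ Nf : ℕ, (Nf = 2 ∨ Nf = 3) → ∃ reg : QCDRegularisation Nf, CoerciveSeaWithoutPinAt Nf reg

/-- The crux at `reg` is exactly "(i) ∧ (ii) at `reg`, with the pin appended under the same
`M₀, b₀, ℓ, m, R`" — recorded as the one-directional projection that is definitionally free. -/
theorem CoerciveSeaAt.withoutPin {Nf : ℕ} {reg : QCDRegularisation Nf} (h : CoerciveSeaAt Nf reg) :
    CoerciveSeaWithoutPinAt Nf reg := by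
  obtain ⟨h1, h2, M₀, hM₀, b₀, hb₀, ℓ, hℓ, hm⟩ := h
  refine ⟨h1, h2, M₀, hM₀, b₀, hb₀, ℓ, hℓ, fun m hmm => ?_⟩
  obtain ⟨R, hR, hi, hii, -⟩ := hm m hmm
  exact ⟨R, hR, hi, hii⟩

/-- The bare valence masses of the heavy junk regularisation are `≥ 1`. [folklore] -/
theorem heavyJunkReg_mq_ge_one (Nf : ℕ) {m : Fin Nf → ℝ} {M₀ : ℝ} (hM₀ : 0 ≤ M₀)
    (hm : ∀ f, M₀ < m f) (k : ℕ) (f : Fin Nf) :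
    (1 : ℝ) ≤ (heavyJunkReg Nf).mcrit k + (heavyJunkReg Nf).a k * m f / (heavyJunkReg Nf).Zm k := by
  have ha := (heavyJunkReg Nf).a_pos k
  have hZ := (heavyJunkReg Nf).Zm_pos k
  have hmf : 0 < m f := hM₀.trans_lt (hm f)
  have h0 : 0 ≤ (heavyJunkReg Nf).a k * m f / (heavyJunkReg Nf).Zm k := by positivity
  change (1 : ℝ) ≤ 1 + _
  linarith

/-- **WITHOUT THE PIN THE HINGE IS TRIVIAL.** The heavy junk regularisation (`canonicalAF` with
`mcrit ≡ 1`, both scalings inherited) satisfies clauses (i) and (ii) of `CoerciveSea` for EVERY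
`N_f`, with `M₀ = 0`, `b₀ = 2`, `ℓ = R = C = α = 1`, `δ ≡ 0`: at its valence masses
`m_f(k) = 1 + a_k m_f/Z_m k ≥ 1` the separator event is empty (`hasSingularSeparator_mass_lt`:
it needs `m_f(k) < t/s₀ ≤ 1/2`) and no cell is a sign defect (`not_isSignDefect`: all Dirichlet
determinants are positive), so every phase-quenched probability in (i),(ii) is `0`. Together with
`not_coerciveSeaAt_heavyJunkReg` (Part A.3): the pin (iii) is the ONLY clause standing between the
hinge and a junk proof — all of its content is "where is `mcrit`". -/
theorem coerciveSeaWithoutPinAt_heavyJunkReg (Nf : ℕ) : CoerciveSeaWithoutPinAt Nf (heavyJunkReg Nf) := by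
  refine ⟨QCDRegularisation.canonicalAF_hasMassScaling, ?_, 0, le_rfl, 2, le_rfl, 1, one_pos,
    fun m hm => ⟨1, one_pos, ?_, ?_⟩⟩
  · exact ⟨1, one_pos, by
      simp [heavyJunkReg, QCDRegularisation.scheme, QCDRegularisation.canonicalAF, QCDScheme.zeroAF]⟩
  · -- clause (i): the separator event is empty at valence masses ≥ 1
    refine ⟨1, one_pos, 1, one_pos, Filter.Eventually.of_forall fun k S _ => ?_⟩
    intro N mq wt P s hs _ f t ht0 ht1
    have hs0 : (2 : ℝ) ≤ (s 0 : ℝ) := by exact_mod_cast (hs 0).1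
    have hmq : (1 : ℝ) ≤ mq f := heavyJunkReg_mq_ge_one Nf le_rfl hm k f
    have hempty : ∀ U : GaugeConfig 4 N (Matrix.specialUnitaryGroup (Fin 3) ℂ),
        ¬ HasSingularSeparator U (mq f) s (t / s 0) := fun U hU => by
      have h1 := hasSingularSeparator_mass_lt hU
      have h2 : |t / (s 0 : ℝ)| ≤ 1 / 2 := by
        rw [abs_of_nonneg (by positivity), div_le_div_iff₀ (by positivity) two_pos]
        linarith
      linarith
    simp only [P, hempty, if_false, zero_mul, integral_zero, zero_div]
    positivity
  · -- clause (ii): no sign defects at valence masses ≥ 1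
    intro ε hε
    refine Filter.Eventually.of_forall fun k S _ => ?_
    intro N mq wt P J
    refine ⟨fun _ => 0, by simp [hε.le], fun j _ s _ => ?_⟩
    have hempty : ∀ U : GaugeConfig 4 N (Matrix.specialUnitaryGroup (Fin 3) ℂ),
        ¬ ∃ f, IsSignDefect U (mq f) j s := fun U ⟨f, hf⟩ => by
      have hmq : (1 : ℝ) ≤ mq f := heavyJunkReg_mq_ge_one Nf le_rfl hm k f
      have h4 : 4 < |mq f + 4| := by rw [abs_of_pos (by linarith)]; linarith
      exact not_isSignDefect U h4 j s hf
    simp only [P, hempty, if_false, zero_mul, integral_zero, zero_div, le_refl]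

/-- Hence the pin-less crux holds outright (for every `N_f`, a fortiori for `N_f ∈ {2,3}`). -/
theorem coerciveSeaWithoutPin_holds : CoerciveSeaWithoutPin :=
  fun Nf _ => ⟨heavyJunkReg Nf, coerciveSeaWithoutPinAt_heavyJunkReg Nf⟩

/-- … while the SAME regularisation is not a witness of the crux (`N_f ≤ 16`): the junk proof of
(i) ∧ (ii) and the pin are mutually exclusive. -/
theorem heavyJunk_dichotomy {Nf : ℕ} (hNf : Nf ≤ 16) :
    CoerciveSeaWithoutPinAt Nf (heavyJunkReg Nf) ∧ ¬ CoerciveSeaAt Nf (heavyJunkReg Nf) :=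
  ⟨coerciveSeaWithoutPinAt_heavyJunkReg Nf, not_coerciveSeaAt_heavyJunkReg hNf⟩



end Summit.QuantumFields.QCD.Theorems.CoerciveSeaNegative

end
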